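import Summits.QuantumFields.YangMills.Theorems.SwapVirialDeficitGnomonicJetLine
import Summits.QuantumFields.YangMills.Theorems.SwapVirialDeficitGnomonicTaylorFour
import HarnessLib

/-!
# W4 (order-4 jets), part K7b: THE σ-GLUED DEFICIT IS `C⁴`-BOUNDED ON THE WHOLE GNOMONIC CHART — Taylor data along EVERY line `s ↦ F̂(η + s ξ)`
# (free-hands support of ⟨stmt-QuantumFields-24197⟩ `SwapVirialDeficit.SwapGluedStiffness`)

Sequel of ✓`…GnomonicJetLine` (K7a: leaders ∕ followers along arbitrary lines of `GnoCoord L` carry 4-jets of the direction's letter sizes) and ✓`…GnomonicTaylorFour`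
(K6: the Euler-ray Taylor data; ✓`abs_taylor_three/four_remainder_le`, ✓`iteratedDeriv_eq_of_hasDerivAt_chain`).  For hub `a ≠ 0`, signs `ε`, ANY base point
`η : GnoCoord L` and ANY direction `ξ` whose letters have Euclidean size `≤ S` (`√Σ(ξ.1.1)ₖ², √Σ(ξ.1.2)ₖ², √Σ(ξ.2.1)ₖ², √Σ(ξ.2.2 i)ₖ² ≤ S`):
* ★★★ `realJet4_gnoDeficit_line_le` — `s ↦ F̂(η + s ξ) = gnoDeficit z χ a ε (η + s • ξ)` has four derivative witnesses on `ℝ` with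
  `|∂ₛ| ≤ 720·L⁴·S`, `|∂ₛ²| ≤ 20400·L⁴·S²`, `|∂ₛ³| ≤ 2484000·L⁴·S³`, `|∂ₛ⁴| ≤ 381240000·L⁴·S⁴` (leaders `≤ 3S`, followers `≤ S`, links `≤ 5S`;
  ✓`jet4_fixHistory`, ✓`realJet4_qDeficit_le`, ✓`swapRingDeficit_eq_qDeficit`);
* ★★★ `taylor_four_gnoDeficit_line` — the same for `deriv` ∕ `iteratedDeriv 2∕3∕4` everywhere, and at `s = 0`:
  `|F̂(η + ξ) − F̂ η − ∂ − ∂²/2| ≤ 2484000·L⁴·S³/2` (CUBIC datum, `1/√b` core) and `|F̂(η + ξ) − F̂ η − ∂ − ∂²/2 − ∂³/6| ≤ 381240000·L⁴·S⁴/6` (QUARTIC datum).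
So the deficit is `C⁴`-bounded in gnomonic coordinates with POLYNOMIAL constants, uniformly in the base point and the hub: the input shape of (T1) (Taylor floor at
the follower minimiser along sup-box segments), (T2) (Hessian Lipschitz along base segments `x₀, y₀`; the hub direction is not a chart coordinate here) and of the
polarisation of ray jets into multilinear bounds (W3) in LEAD g97's steep-window Morse–Bott plan.  The Euler-ray data of K6 are the special case
`η = eulerDilate 0 η₀`, `ξ =` the dilated part (with the slightly sharper transverse size `τ`).

HONEST LABEL: pointwise calculus with explicit polynomial constants; no estimate on the ring's Gibbs state; nothing about ⟨24197⟩ (window-uniform, OPEN), (LW), (M),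
W3∕W5–W9 or any rung is proved; ⟨24194⟩ ∕ ⟨24196⟩ ∕ ⟨24497⟩ OPEN; item of record ⟨24085⟩ SubOctaveBounded aside ∕ untouched; the Yang–Mills mass gap is NOT proved;
no summit is proved by a line.  THEOREMS ONLY (0 `def`, 0 `sorry`), standard axioms, no local instances.  Seat ym-line-fcl-p3 g47 (cell ym-idea-1, free hands),
`--supports stmt-QuantumFields-24197`.  References: [cite: Luscher1983, §2]; [folklore] (Taylor's theorem).
-/

set_option autoImplicit false
set_option synthInstance.maxSize 1024

noncomputable section

open Quaternion Set
open scoped Quaternion BigOperators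
open Literature.MathematicalPhysics.QuantumLattice
open Literature.MathematicalPhysics.QuantumFieldTheory hiding SU2
open Summit.QuantumFields.YangMills.Theorems.FemtoTransferGap
open Summit.QuantumFields.YangMills.Theorems.FemtoTransferGap.TT
open Summit.QuantumFields.YangMills.Theorems.SwapVirialDeficit.BlowUp (qDeficit swapRingDeficit_eq_qDeficit)
open Summit.QuantumFields.YangMills.Theorems.SwapVirialDeficit.BlowUpRing

namespace Summit.QuantumFields.YangMills.Theorems.SwapVirialDeficit.Gnomonic

variable {L : ℕ} [NeZero L]

/-- ★★★ **THE σ-GLUED DEFICIT ALONG ANY LINE OF THE GNOMONIC CHART**: for hub `a ≠ 0`, signs `ε`, base point `η`, direction `ξ` with all letter sizes `≤ S`,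
`s ↦ gnoDeficit z χ a ε (η + s • ξ)` has four derivative witnesses everywhere with `|∂ₛ| ≤ 720L⁴S`, `|∂ₛ²| ≤ 20400L⁴S²`, `|∂ₛ³| ≤ 2484000L⁴S³`,
`|∂ₛ⁴| ≤ 381240000L⁴S⁴`. [cite: Luscher1983, §2] -/
theorem realJet4_gnoDeficit_line_le (z : Fin 3 → Bool) (χ : Site 3 L → SU2) {a : ℍ} (ha : a ≠ 0) (ε : GnoSign L) (η ξ : GnoCoord L) {S : ℝ}
    (hS : 0 ≤ S) (hx : Real.sqrt (∑ k, ξ.1.1 k ^ 2) ≤ S) (hy : Real.sqrt (∑ k, ξ.1.2 k ^ 2) ≤ S) (hz : Real.sqrt (∑ k, ξ.2.1 k ^ 2) ≤ S)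
    (hf : ∀ i, Real.sqrt (∑ k, ξ.2.2 i k ^ 2) ≤ S) :
    ∃ d₁ d₂ d₃ d₄ : ℝ → ℝ, (∀ s, HasDerivAt (fun s : ℝ => gnoDeficit z χ a ε (η + s • ξ)) (d₁ s) s) ∧
      (∀ s, HasDerivAt d₁ (d₂ s) s) ∧ (∀ s, HasDerivAt d₂ (d₃ s) s) ∧ (∀ s, HasDerivAt d₃ (d₄ s) s) ∧
      ∀ s, |d₁ s| ≤ 720 * (L : ℝ) ^ 4 * S ∧ |d₂ s| ≤ 20400 * (L : ℝ) ^ 4 * S ^ 2 ∧ |d₃ s| ≤ 2484000 * (L : ℝ) ^ 4 * S ^ 3 ∧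
        |d₄ s| ≤ 381240000 * (L : ℝ) ^ 4 * S ^ 4 := by
  -- the letters: leaders `≤ 3S`, followers `≤ S`
  have hC : ∀ μ : Fin 4, ∃ f₁ f₂ f₃ f₄ : ℝ → ℍ,
      (∀ s, HasDerivAt (fun s : ℝ => su2Quat ((blowUpPoint (L := L) 1 (gnomonicPoint a ε (η + s • ξ))).1 μ)) (f₁ s) s) ∧ (∀ s, HasDerivAt f₁ (f₂ s) s) ∧
      (∀ s, HasDerivAt f₂ (f₃ s) s) ∧ (∀ s, HasDerivAt f₃ (f₄ s) s) ∧
      ∀ s, ‖su2Quat ((blowUpPoint (L := L) 1 (gnomonicPoint a ε (η + s • ξ))).1 μ)‖ ≤ 1 ∧ ‖f₁ s‖ ≤ 3 * S ∧ ‖f₂ s‖ ≤ (3 * S) ^ 2 ∧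
        ‖f₃ s‖ ≤ 3 * (3 * S) ^ 3 ∧ ‖f₄ s‖ ≤ 9 * (3 * S) ^ 4 :=
    fun μ => jet4_mono (by positivity) (by linarith) (jet4_leader_line ha ε η ξ μ)
  have hU : ∀ i : Fol L, ∃ f₁ f₂ f₃ f₄ : ℝ → ℍ,
      (∀ s, HasDerivAt (fun s : ℝ => su2Quat ((blowUpPoint (L := L) 1 (gnomonicPoint a ε (η + s • ξ))).2 i)) (f₁ s) s) ∧ (∀ s, HasDerivAt f₁ (f₂ s) s) ∧
      (∀ s, HasDerivAt f₂ (f₃ s) s) ∧ (∀ s, HasDerivAt f₃ (f₄ s) s) ∧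
      ∀ s, ‖su2Quat ((blowUpPoint (L := L) 1 (gnomonicPoint a ε (η + s • ξ))).2 i)‖ ≤ 1 ∧ ‖f₁ s‖ ≤ S ∧ ‖f₂ s‖ ≤ S ^ 2 ∧ ‖f₃ s‖ ≤ 3 * S ^ 3 ∧
        ‖f₄ s‖ ≤ 9 * S ^ 4 :=
    fun i => jet4_mono (Real.sqrt_nonneg _) (hf i) (jet4_follower_line a ε η ξ i)
  -- the words and the deficit
  obtain ⟨hl, hs⟩ := jet4_fixHistory (C := fun s => (blowUpPoint (L := L) 1 (gnomonicPoint a ε (η + s • ξ))).1)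
    (U := fun s => (blowUpPoint (L := L) 1 (gnomonicPoint a ε (η + s • ξ))).2) χ (by positivity : (0 : ℝ) ≤ 3 * S) hS hC hU
  have e5 : 3 * S + S + S = 5 * S := by ring
  rw [e5] at hl hs
  have h := realJet4_qDeficit_le (L := L) z (M := 5 * S) (by positivity)
    (Q := fun s => ((fun (i : Fin (2 * L - 1 + 1)) (e : Edge 3 L) =>
        su2Quat ((fixHistory (ringConfig χ (blowUpPoint (L := L) 1 (gnomonicPoint a ε (η + s • ξ))))).1 i e)),
      fun x : Site 3 L => su2Quat ((fixHistory (ringConfig χ (blowUpPoint (L := L) 1 (gnomonicPoint a ε (η + s • ξ))))).2 x)))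
    (fun i e => hl i e) (fun x => hs x)
  have e : (fun s : ℝ => gnoDeficit z χ a ε (η + s • ξ)) = fun s => qDeficit z
      ((fun (i : Fin (2 * L - 1 + 1)) (e : Edge 3 L) => su2Quat ((fixHistory (ringConfig χ (blowUpPoint (L := L) 1 (gnomonicPoint a ε (η + s • ξ))))).1 i e)),
        fun x : Site 3 L => su2Quat ((fixHistory (ringConfig χ (blowUpPoint (L := L) 1 (gnomonicPoint a ε (η + s • ξ))))).2 x)) :=
    funext fun s => swapRingDeficit_eq_qDeficit z _
  rw [e]
  refine realJet4_mono ?_ ?_ ?_ ?_ h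
  · nlinarith [pow_nonneg (Nat.cast_nonneg L : (0 : ℝ) ≤ L) 4]
  · nlinarith [pow_nonneg (Nat.cast_nonneg L : (0 : ℝ) ≤ L) 4, sq_nonneg S]
  · nlinarith [pow_nonneg (Nat.cast_nonneg L : (0 : ℝ) ≤ L) 4, pow_nonneg hS 3]
  · nlinarith [pow_nonneg (Nat.cast_nonneg L : (0 : ℝ) ≤ L) 4, pow_nonneg hS 4]

/-- ★★★ **THE σ-GLUED DEFICIT IS `C⁴`-BOUNDED ON THE WHOLE GNOMONIC CHART** (Taylor data along every line): for hub `a ≠ 0`, signs `ε`, base point `η`,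
direction `ξ` with all letter sizes `≤ S`, and `ψ s = gnoDeficit z χ a ε (η + s • ξ)`: `|ψ′| ≤ 720L⁴S`, `|ψ″| ≤ 20400L⁴S²`, `|ψ‴| ≤ 2484000L⁴S³`,
`|ψ⁗| ≤ 381240000L⁴S⁴` EVERYWHERE, and at `s = 0`
`|F̂(η + ξ) − F̂ η − ψ′ 0 − ψ″ 0/2| ≤ 2484000L⁴S³/2`, `|F̂(η + ξ) − F̂ η − ψ′ 0 − ψ″ 0/2 − ψ‴ 0/6| ≤ 381240000L⁴S⁴/6`. [cite: Luscher1983, §2] -/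
theorem taylor_four_gnoDeficit_line (z : Fin 3 → Bool) (χ : Site 3 L → SU2) {a : ℍ} (ha : a ≠ 0) (ε : GnoSign L) (η ξ : GnoCoord L) {S : ℝ}
    (hS : 0 ≤ S) (hx : Real.sqrt (∑ k, ξ.1.1 k ^ 2) ≤ S) (hy : Real.sqrt (∑ k, ξ.1.2 k ^ 2) ≤ S) (hz : Real.sqrt (∑ k, ξ.2.1 k ^ 2) ≤ S)
    (hf : ∀ i, Real.sqrt (∑ k, ξ.2.2 i k ^ 2) ≤ S) :
    (∀ s, |deriv (fun s : ℝ => gnoDeficit z χ a ε (η + s • ξ)) s| ≤ 720 * (L : ℝ) ^ 4 * S ∧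
        |iteratedDeriv 2 (fun s : ℝ => gnoDeficit z χ a ε (η + s • ξ)) s| ≤ 20400 * (L : ℝ) ^ 4 * S ^ 2 ∧
        |iteratedDeriv 3 (fun s : ℝ => gnoDeficit z χ a ε (η + s • ξ)) s| ≤ 2484000 * (L : ℝ) ^ 4 * S ^ 3 ∧
        |iteratedDeriv 4 (fun s : ℝ => gnoDeficit z χ a ε (η + s • ξ)) s| ≤ 381240000 * (L : ℝ) ^ 4 * S ^ 4) ∧
      |gnoDeficit z χ a ε (η + ξ) - gnoDeficit z χ a ε η - deriv (fun s : ℝ => gnoDeficit z χ a ε (η + s • ξ)) 0 -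
          iteratedDeriv 2 (fun s : ℝ => gnoDeficit z χ a ε (η + s • ξ)) 0 / 2| ≤ 2484000 * (L : ℝ) ^ 4 * S ^ 3 / 2 ∧
      |gnoDeficit z χ a ε (η + ξ) - gnoDeficit z χ a ε η - deriv (fun s : ℝ => gnoDeficit z χ a ε (η + s • ξ)) 0 -
          iteratedDeriv 2 (fun s : ℝ => gnoDeficit z χ a ε (η + s • ξ)) 0 / 2 - iteratedDeriv 3 (fun s : ℝ => gnoDeficit z χ a ε (η + s • ξ)) 0 / 6| ≤
        381240000 * (L : ℝ) ^ 4 * S ^ 4 / 6 := by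
  obtain ⟨d₁, d₂, d₃, d₄, h₁, h₂, h₃, h₄, hb⟩ := realJet4_gnoDeficit_line_le z χ ha ε η ξ hS hx hy hz hf
  obtain ⟨e1, e2, e3, e4⟩ := iteratedDeriv_eq_of_hasDerivAt_chain h₁ h₂ h₃ h₄
  have e1' : gnoDeficit z χ a ε (η + ξ) = (fun s : ℝ => gnoDeficit z χ a ε (η + s • ξ)) 1 := by simp only [one_smul]
  have e0' : gnoDeficit z χ a ε η = (fun s : ℝ => gnoDeficit z χ a ε (η + s • ξ)) 0 := by simp only [zero_smul, add_zero]
  refine ⟨fun s => ?_, ?_, ?_⟩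
  · rw [e1, e2, e3, e4]; exact hb s
  · rw [e1, e2, e1', e0']
    exact abs_taylor_three_remainder_le h₁ h₂ h₃ (fun s _ => (hb s).2.2.1)
  · rw [e1, e2, e3, e1', e0']
    exact abs_taylor_four_remainder_le h₁ h₂ h₃ h₄ (fun s _ => (hb s).2.2.2)

end Summit.QuantumFields.YangMills.Theorems.SwapVirialDeficit.Gnomonic

end
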